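import Literature.NumberTheory.Rogawski1990.U3PrincipalSeriesReducibility            -- ★ NF1 `KeysCaseTwo` :136 (the TARGET), `IrrClass.IsSquareIntegrable`
import Summits.HodgeConjecture.HodgeConjecture.Theorems.F0P3XiPacketFamilyOfRecord    -- ★ `isAdmissible_of_isConstituentOf`, ★ `isAdmissible_cmPrincipalSeries`, `Gqs`
import Literature.NumberTheory.Rogawski1990.KeysCaseTwoReducible                      -- ★ p826369: LETTER N4 `KeysCaseTwoReducible L` [Keys1984 §7 Thm (2)]
import Literature.NumberTheory.Automorphic.U3SquareIntegrableExponents               -- ★ p826342: LETTER N5 `U3SquareIntegrableExponents L` [Casselman1995 Thm. 4.4.6]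
import Literature.NumberTheory.Automorphic.UnitaryGroupPrincipalSeriesExponents      -- ★ p825973: `cmWeylTorusCharPair` (= wχ), `HasJacquetExponent`
import Literature.NumberTheory.Automorphic.CMXiTorusCharSplitTorusDecay             -- ★ p826744 (+ §4 p827853): S4∕S5 `norm_cmXiTorusChar_lt_one`, `exists_torusU_one_lt_norm_conj_inv`
import Literature.NumberTheory.Automorphic.JacquetExponentUnique                     -- ★ p827046: G5 `HasJacquetExponent.eq_of_equiv_twist_trivial`
import Summits.HodgeConjecture.HodgeConjecture.Theorems.F0P3bCentralCharacterUnitaryNonsplit  -- ★ p827424: G3 `exists_centralChar_norm_eq_one_of_nonsplit`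
import Summits.HodgeConjecture.HodgeConjecture.Theorems.F0P3U3LengthLeTwoOfEmbeds            -- ED. 2: ★ p829972 J1 «N3 ⇐ N1 + N2» (brings N1 p826240, N2 p826667, N3 p826287)
import Summits.HodgeConjecture.HodgeConjecture.Theorems.F0P3U3ConstituentEmbedsOfJacquet         -- ED. 2: ★ p831765 «N2 ⇐ N1» (N2 absorbed, no binder)
import Summits.HodgeConjecture.HodgeConjecture.Theorems.F0P3U3PrincipalSeriesJacquetFiltrationHolds  -- ED. 2: ★ p832625 hypothesis-free N1 (N1 absorbed, no binder)
import Summits.HodgeConjecture.HodgeConjecture.Theorems.F0P3KeysLabelledPair                        -- ★ p833040 S2 head `labelledPair_of_reducible` (F0P3-p02 (g8))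
import Summits.HodgeConjecture.HodgeConjecture.Theorems.F0P3U3SquareIntegrableExponentsHolds            -- ED. 3: ★ p834912 hypothesis-free N5 (F0P3-p01 (g10), road R1–R6)
import Summits.HodgeConjecture.HodgeConjecture.Theorems.F0P3KeysCaseTwoReducibleOfN3                  -- ED. 4: ★ B-p14 (g28) FILE 3 `keysCaseTwoReducible_of_N3 (hN3)` — N4 ⟸ the #96 letter
import HarnessLib

/-!
# `F0P3KeysCaseTwoOfStubs` — the SORRY-FREE Theorems twin of the registered pay-down line `Cruxes/H413/Lines/F0_P3_KeysCaseTwoPaydown.lean`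
# (ED. 1 commit a0e8e9e8306e): `KeysCaseTwo L` from the two letters N4, N5 and the labelled-pair junction S2, everything else ★

Cell `hodgecm-mathlib`, F0∕P3 «U3-mult», crux H413 (`stmt-HodgeConjecture-24833`); F0P3b-plan (g10) 19:01:35Z «junction of record = PLAN v12 §1 option (b): a ★
Theorems twin … = T3b ED. 1 §§2–4 minus the five `stub_*`», cut by typ-T3b (g0).  THEOREMS ONLY: no `def`, no instance, no notation, no `sorry`, no named fact.
The two Lines-level abbreviations of the registered line (`HasJacquetChar`, `DecaysOnSplitTorus`) are INLINED here (their bodies verbatim), so that the K9β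
closer can write `stub_Keys := fun L _ _ _ => F0P3KeysCaseTwoOfStubs.keysCaseTwo_of_letters L ‹N4› ‹N5› ‹S2›` BY NAME over: the LETTER ★ `Rogawski1990.KeysCaseTwoReducible L`
(N4, [Keys1984 §7 Thm (2)]), the LETTER ★ `UnitaryGroup.U3SquareIntegrableExponents L` (N5, [Casselman1995 Thm 4.4.6]) and the in-house labelled-pair head S2
(`Theorems/F0P3KeysLabelledPair.labelledPair_of_reducible`, F0P3-p02 (g8), in flight — itself over N1 ∕ N3 ∕ N5 ∕ N5′ by name, with ★ J1 p829972, ★ J2 p830391,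
★ N1-assembler p831336).  HC_CM is proved only modulo the printed citations («named inputs remaining 2») until rung 0 closes; this file discharges no letter.

Contents (all proved; axioms TRIO): `hasJacquetExponent_of_equiv_twist_trivial` (generic: `r(π) ≅ θ ⇒ θ` is an exponent) · `isSquareIntegrable_iff_decays` (S3 junction:
N5 + ★ G3 + ★ G5 ⇒ «an admissible irreducible class with `r(π) ≅ θ` is square-integrable mod centre iff `θ` decays on `A⁻ ∖ A(𝒪)`») · `decays_xi` (S4, ★ p826744) ·
`not_decays_wxi` (S5, ★ p826744) · `keysCaseTwo_of_letters` (the composition: N4 + N5 + S2 ⇒ `KeysCaseTwo L`) · `keysCaseTwoClosed_of_letters` (the `StubKeys`-shaped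
∀-closure).  Print: [Rogawski1990] §12.2 (2) pp. 173–174; [Keys1984] §7 Thm (2) p. 126; [Casselman1995] Thm 4.4.6 p. 45, §7.1 p. 67.
-/

set_option autoImplicit false
set_option linter.dupNamespace false

noncomputable section

open NumberField IsDedekindDomain MeasureTheory
open Literature.NumberTheory.Rogawski1990
open Literature.NumberTheory.Automorphic Literature.NumberTheory.Automorphic.UnitaryGroup
open scoped Matrix NNReal ENNReal Pointwise

namespace Summit.HodgeConjecture.HodgeConjecture.Cruxes.H413.F0P3KeysCaseTwoOfStubs

open Summit.HodgeConjecture.HodgeConjecture.Cruxes.H413.F0P3XiPacketFamilyOfRecord (isAdmissible_of_isConstituentOf)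

variable (L : Type) [Field L] [NumberField L] [IsCMField L]

/-! ## §1 Generic: a one-dimensional normalised Jacquet module `≅ θ` has `θ` as an exponent -/

/-- **`r(π) ≅ θ` ⇒ `θ` IS an exponent** (generic, any parabolic triple; companion of ★ G5 `HasJacquetExponent.eq_of_equiv_twist_trivial`, A-p01 p827046): the vector
`e⁻¹(1)` is a non-zero `θ`-eigenvector of `M` in the normalised Jacquet module. [cite: Casselman1995, §4.4 p. 45] [folklore] -/
theorem hasJacquetExponent_of_equiv_twist_trivial {G : Type*} [Group G] [TopologicalSpace G] [IsTopologicalGroup G]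
    (t : ParabolicTriple G) [LocallyCompactSpace t.P] {V : Type*} [AddCommGroup V] [Module ℂ V]
    {ρ : Representation ℂ G V} {θ : ↥t.M →* ℂˣ}
    (e : (ρ.normalizedJacquet t).Equiv ((Representation.trivial ℂ ↥t.M ℂ).twist θ)) :
    ρ.HasJacquetExponent t θ := by
  refine ⟨e.toLinearEquiv.symm 1, e.toLinearEquiv.symm.map_ne_zero_iff.2 one_ne_zero, fun m => ?_⟩
  apply e.toLinearEquiv.injective
  have h1 : e.toLinearEquiv (ρ.normalizedJacquet t m (e.toLinearEquiv.symm 1)) =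
      ((Representation.trivial ℂ ↥t.M ℂ).twist θ) m (e.toLinearEquiv (e.toLinearEquiv.symm 1)) :=
    Representation.IntertwiningMap.isIntertwining _ _ e.toIntertwiningMap m _
  rw [h1, map_smul, LinearEquiv.apply_symm_apply, Representation.twist_apply, Representation.trivial_apply]

variable (v : HeightOneSpectrum (𝓞 ↥(maximalRealSubfield L)))

/-! ## §2 S3: Casselman's criterion (letter N5) at an irreducible class with one-character Jacquet module -/

set_option maxHeartbeats 4000000 in  -- the letter's literal carrier `↥(unitaryGroupOfForm (conjLocal …) (cmLocalForm L 3 v))` vs `Gqs L v` (defeq ★ `cmDatum_Local_eq`; instance-path unification)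
/-- **S3 «N5 [Casselman1995 Thm 4.4.6] + ★ G3 + ★ G5 ⇒ the square-integrability label of a class is read off its Jacquet character»**: at a non-split `v`, an ADMISSIBLE
irreducible class `c` of `U(Φ₃)(L⁺_v)` some representative of which has normalised Jacquet module `≅ θ` (one character) is square-integrable modulo the centre (★
`IrrClass.IsSquareIntegrable μZ`) iff `‖θ(d(a,1,a⁻¹))‖ < 1` for every `σ`-fixed `a` with `‖a‖ < 1`.  Proof: representative `r`, `e : r(r.ρ) ≅ θ`; admissible (★
`IrrClass.isAdmissible_mk`); unitary central character (★ G3 p827424); every exponent of `r.ρ` is `θ` (★ G5 p827046) and `θ` is one (§1); N5 at `(v, μZ, r.V, r.ρ, ω)`; ★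
`IrrClass.isSquareIntegrable_mk_iff`.  N5 enters as the explicit hypothesis `hN5`. [cite: Casselman1995, Thm 4.4.6 p. 45, Prop. 7.1.3 p. 67] [cite: Rogawski1990, §12.2 (2) pp. 173–174] -/
theorem isSquareIntegrable_iff_decays (hN5 : U3SquareIntegrableExponents L)
    (hns : ∀ w : PlacesOver L v, IsCMField.complexConj L • w.1 = w.1)
    [i1 : MeasurableSpace (Gqs L v ⧸ Subgroup.center (Gqs L v))] [i2 : BorelSpace (Gqs L v ⧸ Subgroup.center (Gqs L v))]
    (μZ : Measure (Gqs L v ⧸ Subgroup.center (Gqs L v))) [i3 : μZ.IsHaarMeasure]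
    (c : IrrClass (Gqs L v)) (θ : ↥(torusU (conjLocal L (IsCMField.complexConj L) v) (cmLocalForm L 3 v)) →* ℂˣ)
    (hc : c.IsAdmissible)
    (hθ : haveI := locallyCompactSpace_cmBorelU L 3 v
      ∃ r : SmoothIrrep (Gqs L v), IrrClass.mk r = c ∧
          Nonempty ((r.ρ.normalizedJacquet (cmBorelTriple L 3 v)).Equiv
            ((Representation.trivial ℂ ↥(torusU (conjLocal L (IsCMField.complexConj L) v) (cmLocalForm L 3 v)) ℂ).twist
              θ))) :
    c.IsSquareIntegrable μZ ↔
      (∀ t : ↥(torusU (conjLocal L (IsCMField.complexConj L) v) (cmLocalForm L 3 v)),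
          conjLocal L (IsCMField.complexConj L) v
              ((torusEntry (conjLocal L (IsCMField.complexConj L) v) (cmLocalForm L 3 v) 0 t : (LocalRing L v)ˣ) : LocalRing L v) =
            ((torusEntry (conjLocal L (IsCMField.complexConj L) v) (cmLocalForm L 3 v) 0 t : (LocalRing L v)ˣ) : LocalRing L v) →
          torusEntry (conjLocal L (IsCMField.complexConj L) v) (cmLocalForm L 3 v) 1 t = 1 →
          unitModulusChar (LocalRing L v) (torusEntry (conjLocal L (IsCMField.complexConj L) v) (cmLocalForm L 3 v) 0 t) < 1 →
          ‖((θ t : ℂˣ) : ℂ)‖ < 1) := by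
  obtain ⟨r, rfl, ⟨e⟩⟩ := hθ
  have hadm : r.ρ.IsAdmissible := (IrrClass.isAdmissible_mk r).1 hc
  obtain ⟨ω, hω, hω1⟩ :=
    @F0P3bCentralCharacterUnitaryNonsplit.exists_centralChar_norm_eq_one_of_nonsplit L _ _ _ 3 v hns r.V _ _ r.ρ r.instIsIrreducible hadm
  haveI := locallyCompactSpace_cmBorelU L 3 v
  have hθexp := hasJacquetExponent_of_equiv_twist_trivial (cmBorelTriple L 3 v) e
  have key := @hN5 v hns i1 i2 μZ i3 r.V _ _ r.ρ hadm ω hω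
  rw [IrrClass.isSquareIntegrable_mk_iff μZ r]
  constructor
  · intro hsq t hfix h1 hm
    exact (key.1 ⟨hω1, hsq⟩).2 θ hθexp t hfix h1 hm
  · intro hdec
    refine (key.2 ⟨hω1, fun χ' hχ' => ?_⟩).2
    rw [hχ'.eq_of_equiv_twist_trivial (cmBorelTriple L 3 v) e]
    exact hdec

/-! ## §3 S4∕S5: the exponents `χ_ξ`, `wχ_ξ` of Keys' case (2) on `A⁻ ∖ A(𝒪)` (★ p826744) -/

/-- **S4 — `χ_ξ = (η̃₁ μ ‖·‖^{1/2}, η₂)` DECAYS**: `‖χ_ξ(d(a,1,a⁻¹))‖ = ‖a‖^{1/2} < 1` for `σ`-fixed `a` with `‖a‖ < 1` (★ `norm_cmXiTorusChar_lt_one`).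
[cite: Casselman1995, Prop. 7.1.3 p. 67] [cite: Rogawski1990, §12.2 (2) p. 174] -/
theorem decays_xi (μ : (LocalRing L v)ˣ →* ℂˣ) (η₁ η₂ : ↥(normOneUnits (conjLocal L (IsCMField.complexConj L) v)) →* ℂˣ)
    (hμ : IsQuadraticCharExtension (conjLocal L (IsCMField.complexConj L) v) μ) :
    (∀ t : ↥(torusU (conjLocal L (IsCMField.complexConj L) v) (cmLocalForm L 3 v)),
          conjLocal L (IsCMField.complexConj L) v
              ((torusEntry (conjLocal L (IsCMField.complexConj L) v) (cmLocalForm L 3 v) 0 t : (LocalRing L v)ˣ) : LocalRing L v) =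
            ((torusEntry (conjLocal L (IsCMField.complexConj L) v) (cmLocalForm L 3 v) 0 t : (LocalRing L v)ˣ) : LocalRing L v) →
          torusEntry (conjLocal L (IsCMField.complexConj L) v) (cmLocalForm L 3 v) 1 t = 1 →
          unitModulusChar (LocalRing L v) (torusEntry (conjLocal L (IsCMField.complexConj L) v) (cmLocalForm L 3 v) 0 t) < 1 →
          ‖(((cmXiTorusChar L v μ η₁ η₂) t : ℂˣ) : ℂ)‖ < 1) :=
  fun t hfix h1 hm => norm_cmXiTorusChar_lt_one L v μ η₁ η₂ hμ t hfix h1 hm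

/-- **S5 — `wχ_ξ = (χ̄_ξ,1⁻¹, η₂)` does NOT decay**: at `a = Nm(v)`, `‖wχ_ξ(d(a,1,a⁻¹))‖ = ‖a‖^{-1/2} > 1` (★ `exists_torusU_one_lt_norm_conj_inv`).
[cite: Casselman1995, Thm 4.4.6 (b) p. 45] [cite: Rogawski1990, §12.2 (2) p. 174] -/
theorem not_decays_wxi (μ : (LocalRing L v)ˣ →* ℂˣ) (η₁ η₂ : ↥(normOneUnits (conjLocal L (IsCMField.complexConj L) v)) →* ℂˣ)
    (hμ : IsQuadraticCharExtension (conjLocal L (IsCMField.complexConj L) v) μ) :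
    ¬ (∀ t : ↥(torusU (conjLocal L (IsCMField.complexConj L) v) (cmLocalForm L 3 v)),
          conjLocal L (IsCMField.complexConj L) v
              ((torusEntry (conjLocal L (IsCMField.complexConj L) v) (cmLocalForm L 3 v) 0 t : (LocalRing L v)ˣ) : LocalRing L v) =
            ((torusEntry (conjLocal L (IsCMField.complexConj L) v) (cmLocalForm L 3 v) 0 t : (LocalRing L v)ˣ) : LocalRing L v) →
          torusEntry (conjLocal L (IsCMField.complexConj L) v) (cmLocalForm L 3 v) 1 t = 1 →
          unitModulusChar (LocalRing L v) (torusEntry (conjLocal L (IsCMField.complexConj L) v) (cmLocalForm L 3 v) 0 t) < 1 →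
          ‖(((cmWeylTorusCharPair L v
                (η₁.comp (quotConj (conjLocal L (IsCMField.complexConj L) v) (conjLocal_conjLocal_cm L v)) * μ *
                  halfModulusChar (LocalRing L v)) η₂) t : ℂˣ) : ℂ)‖ < 1) := by
  intro hdec
  obtain ⟨t, hfix, h1, hm, hlt⟩ := exists_torusU_one_lt_norm_conj_inv L v μ η₁ η₂ hμ
  exact absurd (hdec t hfix h1 hm) (not_lt.2 hlt.le)

/-! ## §4 The composition: N4 + N5 + S2 ⇒ `KeysCaseTwo L` -/

set_option maxHeartbeats 3000000 in  -- instance-path unification `IrrClass (Gqs L v)` ↔ the literal carrier of `KeysCaseTwo` (≈ 10⁶ beats, < 30 s wall)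
/-- **`KeysCaseTwo L` FROM THE TWO LETTERS AND THE LABELLED PAIR** (sorry-free): N4 ⇒ `i_G(χ_ξ)` reducible at every non-split `v`; S2 ⇒ the labelled pair `(πs, πn)` with
the exact constituent list and one-character Jacquet modules `χ_ξ`, `wχ_ξ`; both classes are admissible (★ `isAdmissible_cmPrincipalSeries`, ★ `isAdmissible_of_isConstituentOf`);
S3 (N5) at `πs` with S4 ⇒ `πs` square-integrable; S3 at `πn` with S5 ⇒ `πn` not.  The hypothesis `hS2` is the conclusion shape of the registered line's
`stub_labelledPair_of_reducible` with `HasJacquetChar` inlined (= F0P3-p02 (g8)'s head `labelledPair_of_reducible`, modulo its own by-name letters).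
[cite: Rogawski1990, §12.2 (2) pp. 173–174] [cite: Keys1984, §7 Theorem (2) p. 126] [cite: Casselman1995, Thm 4.4.6 p. 45, §7.1 p. 67] -/
theorem keysCaseTwo_of_letters
    (hN4 : KeysCaseTwoReducible L) (hN5 : U3SquareIntegrableExponents L)
    (hS2 : ∀ (v : HeightOneSpectrum (𝓞 ↥(maximalRealSubfield L))),
      (∀ w : PlacesOver L v, IsCMField.complexConj L • w.1 = w.1) →
      ∀ (μ : (LocalRing L v)ˣ →* ℂˣ) (η₁ η₂ : ↥(normOneUnits (conjLocal L (IsCMField.complexConj L) v)) →* ℂˣ),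
        IsQuadraticCharExtension (conjLocal L (IsCMField.complexConj L) v) μ →
        Continuous (fun x => ((μ x : ℂˣ) : ℂ)) → Continuous (fun x => ((η₁ x : ℂˣ) : ℂ)) → Continuous (fun x => ((η₂ x : ℂˣ) : ℂ)) →
        (∃ N : Subrepresentation (cmPrincipalSeries L 3 v (cmXiTorusChar L v μ η₁ η₂)), N ≠ ⊥ ∧ N ≠ ⊤) →
        ∃ πs πn : IrrClass (Gqs L v), πs ≠ πn ∧
          (∀ c : IrrClass (Gqs L v), c.IsConstituentOf (cmPrincipalSeries L 3 v (cmXiTorusChar L v μ η₁ η₂)) ↔ (c = πn ∨ c = πs)) ∧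
          (haveI := locallyCompactSpace_cmBorelU L 3 v
           ∃ r : SmoothIrrep (Gqs L v), IrrClass.mk r = πs ∧
          Nonempty ((r.ρ.normalizedJacquet (cmBorelTriple L 3 v)).Equiv
            ((Representation.trivial ℂ ↥(torusU (conjLocal L (IsCMField.complexConj L) v) (cmLocalForm L 3 v)) ℂ).twist
              (cmXiTorusChar L v μ η₁ η₂)))) ∧
          (haveI := locallyCompactSpace_cmBorelU L 3 v
           ∃ r : SmoothIrrep (Gqs L v), IrrClass.mk r = πn ∧
          Nonempty ((r.ρ.normalizedJacquet (cmBorelTriple L 3 v)).Equiv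
            ((Representation.trivial ℂ ↥(torusU (conjLocal L (IsCMField.complexConj L) v) (cmLocalForm L 3 v)) ℂ).twist
              (cmWeylTorusCharPair L v
                (η₁.comp (quotConj (conjLocal L (IsCMField.complexConj L) v) (conjLocal_conjLocal_cm L v)) * μ *
                  halfModulusChar (LocalRing L v)) η₂))))) :
    KeysCaseTwo L := by
  intro v hns μ η₁ η₂ hμ hμc h1c h2c _i1 _i2 μZ _i3
  have H2 := hS2 v hns μ η₁ η₂ hμ hμc h1c h2c (hN4 v hns μ η₁ η₂ hμ hμc h1c h2c)
  cases H2 with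
  | intro πs H2' =>
    cases H2' with
    | intro πn H3 =>
      -- both labelled classes are admissible: constituents of the admissible `i_G(χ_ξ)` (★ Iwasawa at every `v`)
      have hadm := F0P3XiUnramNonsplitInstance.isAdmissible_cmPrincipalSeries L v (cmXiTorusChar L v μ η₁ η₂)
      have hπs : πs.IsAdmissible := isAdmissible_of_isConstituentOf ((H3.2.1 πs).2 (Or.inr rfl)) hadm
      have hπn : πn.IsAdmissible := isAdmissible_of_isConstituentOf ((H3.2.1 πn).2 (Or.inl rfl)) hadm
      have hs : πs.IsSquareIntegrable μZ :=
        (@isSquareIntegrable_iff_decays L _ _ _ v hN5 hns _i1 _i2 μZ _i3 πs _ hπs H3.2.2.1).2 (decays_xi L v μ η₁ η₂ hμ)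
      have hn : ¬ πn.IsSquareIntegrable μZ := fun hsq =>
        not_decays_wxi L v μ η₁ η₂ hμ ((@isSquareIntegrable_iff_decays L _ _ _ v hN5 hns _i1 _i2 μZ _i3 πn _ hπn H3.2.2.2).1 hsq)
      exact ⟨πs, πn, H3.1, H3.2.1, hs, hn⟩

set_option maxHeartbeats 400000 in
/-- **The `StubKeys`-shaped ∀-closure** (= the type of `stub_Keys` of the K9β closer `Lines/F0_U3LettersRung1.lean`, `∀ L [Field L] [NumberField L] [IsCMField L],
KeysCaseTwo L`, and of the registered line's `KeysCaseTwoClosed`) from the letters N4, N5 and the junction S2 at every CM field.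
[cite: Rogawski1990, §12.2 (2) pp. 173–174] -/
theorem keysCaseTwoClosed_of_letters
    (hN4 : ∀ (L : Type) [Field L] [NumberField L] [IsCMField L], KeysCaseTwoReducible L)
    (hN5 : ∀ (L : Type) [Field L] [NumberField L] [IsCMField L], U3SquareIntegrableExponents L)
    (hS2 : ∀ (L : Type) [Field L] [NumberField L] [IsCMField L] (v : HeightOneSpectrum (𝓞 ↥(maximalRealSubfield L))),
      (∀ w : PlacesOver L v, IsCMField.complexConj L • w.1 = w.1) →
      ∀ (μ : (LocalRing L v)ˣ →* ℂˣ) (η₁ η₂ : ↥(normOneUnits (conjLocal L (IsCMField.complexConj L) v)) →* ℂˣ),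
        IsQuadraticCharExtension (conjLocal L (IsCMField.complexConj L) v) μ →
        Continuous (fun x => ((μ x : ℂˣ) : ℂ)) → Continuous (fun x => ((η₁ x : ℂˣ) : ℂ)) → Continuous (fun x => ((η₂ x : ℂˣ) : ℂ)) →
        (∃ N : Subrepresentation (cmPrincipalSeries L 3 v (cmXiTorusChar L v μ η₁ η₂)), N ≠ ⊥ ∧ N ≠ ⊤) →
        ∃ πs πn : IrrClass (Gqs L v), πs ≠ πn ∧
          (∀ c : IrrClass (Gqs L v), c.IsConstituentOf (cmPrincipalSeries L 3 v (cmXiTorusChar L v μ η₁ η₂)) ↔ (c = πn ∨ c = πs)) ∧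
          (haveI := locallyCompactSpace_cmBorelU L 3 v
           ∃ r : SmoothIrrep (Gqs L v), IrrClass.mk r = πs ∧
          Nonempty ((r.ρ.normalizedJacquet (cmBorelTriple L 3 v)).Equiv
            ((Representation.trivial ℂ ↥(torusU (conjLocal L (IsCMField.complexConj L) v) (cmLocalForm L 3 v)) ℂ).twist
              (cmXiTorusChar L v μ η₁ η₂)))) ∧
          (haveI := locallyCompactSpace_cmBorelU L 3 v
           ∃ r : SmoothIrrep (Gqs L v), IrrClass.mk r = πn ∧
          Nonempty ((r.ρ.normalizedJacquet (cmBorelTriple L 3 v)).Equiv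
            ((Representation.trivial ℂ ↥(torusU (conjLocal L (IsCMField.complexConj L) v) (cmLocalForm L 3 v)) ℂ).twist
              (cmWeylTorusCharPair L v
                (η₁.comp (quotConj (conjLocal L (IsCMField.complexConj L) v) (conjLocal_conjLocal_cm L v)) * μ *
                  halfModulusChar (LocalRing L v)) η₂))))) :
    ∀ (L : Type) [Field L] [NumberField L] [IsCMField L], KeysCaseTwo L :=
  fun L _ _ _ => keysCaseTwo_of_letters L (hN4 L) (hN5 L) (hS2 L)


/-! ## §4 — ED. 2 (APPEND-ONLY on ED. 1 e8006075cc8e23bb; closer desk F0P3-plan (g7) 19:10:05Z; desk F0P3b-plan (g10) rebase of pre-cut a589ed1894c2b798):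
the by-name head the K9β closer's ED. 10 junction applies ONCE — `stub_Keys := fun L _ _ _ => keysCaseTwo_of_stubs L (stub_N4 L) (stub_N5 L)` -/

set_option synthInstance.maxHeartbeats 400000 in
set_option maxHeartbeats 4000000 in  -- instance-path unification with ★ p833040's elaboration of the CM carrier (≈ 10⁶ beats)
/-- **`KeysCaseTwo L` FROM THE TWO NAMED PRINT LETTERS N4, N5** — `hN4` [Keys1984 §7 Thm (2); Rogawski1990 §12.2 (2)], `hN5` [Casselman1995 Thm 4.4.6];
N1 [Casselman1995 L. 7.1.1 (a)] is PROVED IN THE TREE (★ p832625) and N2 [Casselman1995 Cor. 6.3.9 (b)] is DERIVED from it (★ p831765), both inside, no binders;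
N3 [Casselman1995 Cor. 7.1.2] is DERIVED inside by the ★ junction J1 p829972 `u3PrincipalSeriesLengthLeTwo_of_embeds`; the labelled pair S2 is F0P3-p02 (g8)'s
in-house head ★ p833040 `F0P3KeysLabelledPair.labelledPair_of_reducible` (Casselman §7.1 over N1∕N2∕N3), applied once; everything else is ED. 1's `keysCaseTwo_of_letters`.
The junction between p833040's elaboration of the CM carrier ∕ Jacquet clause and this file's costs ≈ 10⁶ heartbeats of instance-path unification (default 2·10⁵ times out;
isolated under `set_option … in`, as in p833040's own header and the registered line's S3).
[cite: Rogawski1990, §12.2 (2) pp. 173–174] [cite: Keys1984, §7 Theorem (2) p. 126] [cite: Casselman1995, Thm 4.4.6, Lemma 7.1.1 (a), Cor. 6.3.9 (b), Cor. 7.1.2, Prop. 7.1.3] -/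
theorem keysCaseTwo_of_stubs
    (hN4 : KeysCaseTwoReducible L) (hN5 : U3SquareIntegrableExponents L) :
    KeysCaseTwo L :=
  -- N1 [Casselman1995 L. 7.1.1 (a)] is PROVED IN THE TREE (★ p832625, γ-W road) — no binder (closer desk: binders only for still-open letters)
  have hN1 : U3PrincipalSeriesJacquetFiltration L := F0P3U3PrincipalSeriesJacquetFiltrationHolds.U3PrincipalSeriesJacquetFiltration_holds L
  -- N2 [Casselman1995 Cor. 6.3.9 (b)] is DERIVED from N1 (★ p831765, N6 ★ inside) — no binder
  have hN2 : U3PrincipalSeriesConstituentEmbeds L :=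
    F0P3U3ConstituentEmbedsOfJacquet.u3PrincipalSeriesConstituentEmbeds_of_jacquetFiltration L hN1
  keysCaseTwo_of_letters L hN4 hN5
    (fun v hns μ η₁ η₂ hμ hμc h1c h2c hred =>
      -- S2 ★ p833040 (F0P3-p02 (g8)): the labelled pair over N1, N2, N3 (N3 derived by ★ J1 p829972); one application
      F0P3KeysLabelledPair.labelledPair_of_reducible L v hN1 hN2
        (F0P3U3LengthLeTwoOfEmbeds.u3PrincipalSeriesLengthLeTwo_of_embeds L hN1 hN2) hns μ η₁ η₂ hμ hμc h1c h2c hred)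

/-- **The `StubKeys`-shaped ∀-closure from the two print letters** (conclusion = `∀ L [Field L] [NumberField L] [IsCMField L], KeysCaseTwo L` = `StubKeys` body char for char;
REF1 (g7) kernel identity 18:59:52Z). [cite: Rogawski1990, §12.2 (2) pp. 173–174] -/
theorem keysCaseTwoClosed_of_stubs
    (hN4 : ∀ (L : Type) [Field L] [NumberField L] [IsCMField L], KeysCaseTwoReducible L)
    (hN5 : ∀ (L : Type) [Field L] [NumberField L] [IsCMField L], U3SquareIntegrableExponents L) :
    ∀ (L : Type) [Field L] [NumberField L] [IsCMField L], KeysCaseTwo L :=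
  fun L _ _ _ => keysCaseTwo_of_stubs L (hN4 L) (hN5 L)

/-! ## §5 — ED. 3 (APPEND-ONLY on ED. 2 2eb6d2e3a463b4d0): N5 [Casselman1995 Thm 4.4.6] is PROVED IN THE TREE (★ p834912); the closer's junction becomes
`stub_Keys := fun L _ _ _ => keysCaseTwo_of_N4 L (stub_N4 L)` — ONE print letter left on the Keys line: N4 [Keys1984 §7 Thm (2)] -/

/-- **`KeysCaseTwo L` FROM THE ONE REMAINING PRINT LETTER N4** [Keys1984 §7 Thm (2); Rogawski1990 §12.2 (2)] — N5 (Casselman's criterion for `U(3)`) is now the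
★ hypothesis-free `F0P3U3SquareIntegrableExponentsHolds.u3SquareIntegrableExponents_holds`. [cite: Rogawski1990, §12.2 (2) pp. 173–174] [cite: Keys1984, §7 Theorem (2) p. 126] [cite: Casselman1995, Thm 4.4.6] -/
theorem keysCaseTwo_of_N4 (hN4 : KeysCaseTwoReducible L) : KeysCaseTwo L :=
  keysCaseTwo_of_stubs L hN4 (F0P3U3SquareIntegrableExponentsHolds.u3SquareIntegrableExponents_holds L)

/-- The `StubKeys`-shaped ∀-closure from the one remaining print letter N4. [cite: Rogawski1990, §12.2 (2) pp. 173–174] -/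
theorem keysCaseTwoClosed_of_N4
    (hN4 : ∀ (L : Type) [Field L] [NumberField L] [IsCMField L], KeysCaseTwoReducible L) :
    ∀ (L : Type) [Field L] [NumberField L] [IsCMField L], KeysCaseTwo L :=
  fun L _ _ _ => keysCaseTwo_of_N4 L (hN4 L)

/-! ## §5b — ED. 4 (APPEND-ONLY on ED. 3 3a86dc20c74abca7): N4 [Keys1984 §7 Thm (2)] CLOSED-DERIVED from the #96 letter `thetaType_nonsplit_jacquetModule`
(B-p14 (g28) FILE 3 ★ `F0P3KeysCaseTwoReducibleOfN3.keysCaseTwoReducible_of_N3` over B-p10 (1b) ★ p835647 + GLOB ★ p834791 + reparametrisation ★ p835601) — the twin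
reads `KeysCaseTwo L` modulo #96 ALONE -/

/-- **`KeysCaseTwo L` FROM THE ONE PRINT LETTER #96** [GelbartRogawski1991 §3.2 (3.2.1)–(3.2.2); Kudla1986 Thm. 2.8]: Keys' case (2) [Keys1984 §7 Thm (2)] is
DERIVED in the tree from the Jacquet module of the local theta type (★ `keysCaseTwoReducible_of_N3`: globalise the local case-two character ★ p834791, the
Weil-representation constituent of `i_G(χ_ξ)` ★, the Jacquet clash ★), N5 [Casselman1995 Thm 4.4.6] is proved in the tree (★ p834912), and S2 is ★ p833040 — so
Rogawski's NF1 holds modulo the single print letter `h96`. [cite: Rogawski1990, §12.2 (2) pp. 173–174] [cite: GelbartRogawski1991, §3.2 (3.2.1)–(3.2.2) p. 457; Lem. 5.1.2 p. 466]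
[cite: Keys1984, §7 Theorem (2) p. 126] [cite: Casselman1995, Thm 4.4.6] -/
theorem keysCaseTwo_of_thetaType (h96 : Literature.NumberTheory.GelbartRogawski1991.thetaType_nonsplit_jacquetModule) : KeysCaseTwo L :=
  keysCaseTwo_of_N4 L (F0P3KeysCaseTwoReducibleOfN3.keysCaseTwoReducible_of_N3 L h96)

/-- The `StubKeys`-shaped ∀-closure from the one print letter #96. [cite: Rogawski1990, §12.2 (2) pp. 173–174] [cite: GelbartRogawski1991, §3.2 p. 457] -/
theorem keysCaseTwoClosed_of_thetaType (h96 : Literature.NumberTheory.GelbartRogawski1991.thetaType_nonsplit_jacquetModule) :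
    ∀ (L : Type) [Field L] [NumberField L] [IsCMField L], KeysCaseTwo L :=
  fun L _ _ _ => keysCaseTwo_of_thetaType L h96

end Summit.HodgeConjecture.HodgeConjecture.Cruxes.H413.F0P3KeysCaseTwoOfStubs

end
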